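import Summits.AtomisticToContinuum.Crystallization.Theorems.OverbindingBudgetAffineRunCutForgone
import Summits.AtomisticToContinuum.Crystallization.Theorems.OverbindingBudgetAffineTwinGainScaling
import Literature.MathematicalPhysics.StatisticalMechanics.HcpFccLatticeSumsEval

/-!
# `OverbindingBudget` / crux `RobustDefectLimitWindows` (stmt-AtomisticToContinuum-31280) — «RunCut»: third-order expansion of the layer sums in the axial ratio

Support file (lens-4 g86, hand-in 3 part 0 for the competitor leaf **SW♭** `StackSwapGainFlat(Wide)`; memo `g86/memo/SW-G1.md` §7).  The
analytic half of the AXIAL WINDOW lane.  The competitor's affine charts fix the in-plane scale `a` but let the interlayer spacing `h` vary in the window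
`|t − 2/3| ≤ 1/340`, `t = (h/a)²`; the column certificates of `…RunCutColumnGain` are stated at the ideal `t = 2/3`.  This file supplies

* §1 the third-order remainder of `x⁻⁶`: `|(P+Δ)⁻⁶ − P⁻⁶ + 6ΔP⁻⁷ − 21Δ²P⁻⁸| ≤ 200|Δ|³P⁻⁹` for `8|Δ| ≤ P` (exact identity; the `x⁻³` analogue is
  `…RunCutForgone.inv_pow_three_taylor3`);
* §2 termwise and §3 summed third-order expansions of the kit's layer sums `L^δ_n(s) = layerSum δ n s` in `s` (every layer term is `(Q + s)⁻ⁿ` with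
  `Q = stackForm ≥ 0`, so the scalar lemmas apply term by term and sum by `Summable.tsum_le_tsum`):
  `|L₃(s₀+Δ) − L₃(s₀) + 3Δ·L₄(s₀) − 6Δ²·L₅(s₀)| ≤ 18|Δ|³·L₆(s₀)`, `|L₆(s₀+Δ) − L₆(s₀) + 6Δ·L₇(s₀) − 21Δ²·L₈(s₀)| ≤ 200|Δ|³·L₉(s₀)`
  (`0 < s₀`, `8|Δ| ≤ s₀`), and §4 the registry versions for `J⁽ⁿ⁾ = registryCoupling n = L⁰_n − L¹_n`;
* §5 the bridge at a GENERAL axial ratio: `barlowCoupling lennardJones a (a√t) k = (1/12)a⁻¹²·J⁽⁶⁾(k²t) − (1/6)a⁻⁶·J⁽³⁾(k²t)` (`0 ≤ t`; the tree's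
  `…TwinGainScaling.barlowCoupling_lennardJones_ideal` is `t = 2/3`), with its signed / absolute corollaries.

The coefficients `J⁽⁴⁾, J⁽⁵⁾, J⁽⁷⁾, J⁽⁸⁾` at the ideal points are enclosed in `…RunCutAxial` (`k = 2`) and `…RunCutAxialLaneA/B`; the window column
certificate is assembled in `…RunCutAxialWindow`.
[this file: 0 definitions, 16 theorems; standard axioms]
-/

noncomputable section

namespace Summit.AtomisticToContinuum.Crystallization.Theorems.OverbindingBudgetAffineRunCutAxialTaylor

open Literature.MathematicalPhysics.StatisticalMechanics
open Literature.MathematicalPhysics.StatisticalMechanics.StackingSums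
open Summit.AtomisticToContinuum.Crystallization.Theorems.OverbindingBudgetAffineRunCutForgone (inv_pow_three_taylor3)
open Summit.AtomisticToContinuum.Crystallization.Theorems.OverbindingBudgetAffineTwinGainScaling (planar_eq_stackForm lennardJones_of_sq)

/-! ## §1 Third-order remainder of `x⁻⁶` -/

/-- `|(P+t)⁻⁶ − P⁻⁶ + 6tP⁻⁷ − 21t²P⁻⁸| ≤ 200|t|³P⁻⁹` for `8|t| ≤ P` (exact identity with numerator
`−t³(56P⁵ + 210P⁴t + 336P³t² + 280P²t³ + 120Pt⁴ + 21t⁵)` over `P⁸(P+t)⁶`; `|…| ≤ 89P⁵`, `(P+t)⁶ ≥ (7P/8)⁶`). [folklore] -/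
theorem inv_pow_six_taylor3 {P t : ℝ} (hP : 0 < P) (ht : 8 * |t| ≤ P) :
    |((P + t)⁻¹) ^ 6 - (P⁻¹) ^ 6 + 6 * t * (P⁻¹) ^ 7 - 21 * t ^ 2 * (P⁻¹) ^ 8| ≤ 200 * |t| ^ 3 * (P⁻¹) ^ 9 := by
  have h8 : |t| ≤ P / 8 := by linarith
  have ht1 : -(P / 8) ≤ t := by linarith [neg_abs_le t]
  have ht2 : t ≤ P / 8 := by linarith [le_abs_self t]
  have hPt : 0 < P + t := by linarith
  have key : ((P + t)⁻¹) ^ 6 - (P⁻¹) ^ 6 + 6 * t * (P⁻¹) ^ 7 - 21 * t ^ 2 * (P⁻¹) ^ 8 =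
      -(t ^ 3 * (56 * P ^ 5 + 210 * P ^ 4 * t + 336 * P ^ 3 * t ^ 2 + 280 * P ^ 2 * t ^ 3 +
        120 * P * t ^ 4 + 21 * t ^ 5)) / (P ^ 8 * (P + t) ^ 6) := by
    field_simp
    ring
  have hden : 0 < P ^ 8 * (P + t) ^ 6 := by positivity
  have hA : |56 * P ^ 5 + 210 * P ^ 4 * t + 336 * P ^ 3 * t ^ 2 + 280 * P ^ 2 * t ^ 3 + 120 * P * t ^ 4 + 21 * t ^ 5|
      ≤ 89 * P ^ 5 := by
    have m2 : t ^ 2 ≤ (P / 8) ^ 2 := sq_le_sq' ht1 ht2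
    have m3 := abs_le.1 (show |t ^ 3| ≤ (P / 8) ^ 3 by rw [abs_pow]; exact pow_le_pow_left₀ (abs_nonneg t) h8 3)
    have m4 : t ^ 4 ≤ (P / 8) ^ 4 := by
      have h := pow_le_pow_left₀ (abs_nonneg t) h8 4
      rwa [Even.pow_abs ⟨2, rfl⟩] at h
    have m5 := abs_le.1 (show |t ^ 5| ≤ (P / 8) ^ 5 by rw [abs_pow]; exact pow_le_pow_left₀ (abs_nonneg t) h8 5)
    have b1 : P ^ 4 * t ≤ P ^ 4 * (P / 8) := mul_le_mul_of_nonneg_left ht2 (by positivity)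
    have b1' : P ^ 4 * (-(P / 8)) ≤ P ^ 4 * t := mul_le_mul_of_nonneg_left ht1 (by positivity)
    have b2 : P ^ 3 * t ^ 2 ≤ P ^ 3 * (P / 8) ^ 2 := mul_le_mul_of_nonneg_left m2 (by positivity)
    have b2' : 0 ≤ P ^ 3 * t ^ 2 := by positivity
    have b3 : P ^ 2 * t ^ 3 ≤ P ^ 2 * (P / 8) ^ 3 := mul_le_mul_of_nonneg_left m3.2 (by positivity)
    have b3' : P ^ 2 * (-((P / 8) ^ 3)) ≤ P ^ 2 * t ^ 3 := mul_le_mul_of_nonneg_left m3.1 (by positivity)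
    have b4 : P * t ^ 4 ≤ P * (P / 8) ^ 4 := mul_le_mul_of_nonneg_left m4 hP.le
    have b4' : 0 ≤ P * t ^ 4 := by positivity
    have hP5 : 0 < P ^ 5 := by positivity
    rw [abs_le]; constructor <;> nlinarith [m5.1, m5.2]
  have hD : P ^ 8 * (7 / 8 * P) ^ 6 ≤ P ^ 8 * (P + t) ^ 6 :=
    mul_le_mul_of_nonneg_left (pow_le_pow_left₀ (by positivity) (by linarith) 6) (by positivity)
  rw [key, abs_div, abs_neg, abs_mul, abs_pow, abs_of_pos hden, div_le_iff₀ hden]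
  calc |t| ^ 3 * |56 * P ^ 5 + 210 * P ^ 4 * t + 336 * P ^ 3 * t ^ 2 + 280 * P ^ 2 * t ^ 3 + 120 * P * t ^ 4 + 21 * t ^ 5|
        ≤ |t| ^ 3 * (89 * P ^ 5) := mul_le_mul_of_nonneg_left hA (by positivity)
    _ ≤ 200 * |t| ^ 3 * (P⁻¹) ^ 9 * (P ^ 8 * (7 / 8 * P) ^ 6) := by
        have e : 200 * |t| ^ 3 * (P⁻¹) ^ 9 * (P ^ 8 * (7 / 8 * P) ^ 6) = 2941225 / 32768 * (|t| ^ 3 * P ^ 5) := by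
          field_simp
          ring
        rw [e]
        nlinarith [show 0 ≤ |t| ^ 3 * P ^ 5 by positivity]
    _ ≤ 200 * |t| ^ 3 * (P⁻¹) ^ 9 * (P ^ 8 * (P + t) ^ 6) := mul_le_mul_of_nonneg_left hD (by positivity)

/-! ## §2 Termwise expansions of the layer terms -/

/-- Termwise, exponent `3`: `|T₃(s₀+Δ) − T₃(s₀) + 3Δ·T₄(s₀) − 6Δ²·T₅(s₀)| ≤ 18|Δ|³·T₆(s₀)` for the layer term `T_n(s) = (stackForm + s)⁻ⁿ`
(`0 < s₀`, `8|Δ| ≤ s₀`). [this file · kind: proof] -/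
theorem layerTerm_three_taylor {δ : ℕ} (hδ : δ ≤ 1) {s₀ Δ : ℝ} (hs : 0 < s₀) (hΔ : 8 * |Δ| ≤ s₀) (ij : ℤ × ℤ) :
    |layerTerm δ 3 (s₀ + Δ) ij - layerTerm δ 3 s₀ ij + 3 * Δ * layerTerm δ 4 s₀ ij - 6 * Δ ^ 2 * layerTerm δ 5 s₀ ij|
      ≤ 18 * |Δ| ^ 3 * layerTerm δ 6 s₀ ij := by
  have hQ := stackForm_nonneg hδ ij.1 ij.2
  unfold layerTerm
  rw [show stackForm δ ij.1 ij.2 + (s₀ + Δ) = (stackForm δ ij.1 ij.2 + s₀) + Δ by ring]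
  exact inv_pow_three_taylor3 (by linarith) (by linarith)

/-- Termwise, exponent `6`: `|T₆(s₀+Δ) − T₆(s₀) + 6Δ·T₇(s₀) − 21Δ²·T₈(s₀)| ≤ 200|Δ|³·T₉(s₀)`. [this file · kind: proof] -/
theorem layerTerm_six_taylor {δ : ℕ} (hδ : δ ≤ 1) {s₀ Δ : ℝ} (hs : 0 < s₀) (hΔ : 8 * |Δ| ≤ s₀) (ij : ℤ × ℤ) :
    |layerTerm δ 6 (s₀ + Δ) ij - layerTerm δ 6 s₀ ij + 6 * Δ * layerTerm δ 7 s₀ ij - 21 * Δ ^ 2 * layerTerm δ 8 s₀ ij|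
      ≤ 200 * |Δ| ^ 3 * layerTerm δ 9 s₀ ij := by
  have hQ := stackForm_nonneg hδ ij.1 ij.2
  unfold layerTerm
  rw [show stackForm δ ij.1 ij.2 + (s₀ + Δ) = (stackForm δ ij.1 ij.2 + s₀) + Δ by ring]
  exact inv_pow_six_taylor3 (by linarith) (by linarith)

/-! ## §3 Summed expansions of the layer sums -/

/-- Summation of a termwise two-sided bound: if `|f ij| ≤ c·g ij` termwise with `f`, `g` summable then `|∑' f| ≤ c·∑' g`. [folklore] -/
theorem abs_tsum_le_of_abs_le {f g : ℤ × ℤ → ℝ} {c : ℝ} (hf : Summable f) (hg : Summable g)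
    (h : ∀ ij, |f ij| ≤ c * g ij) : |∑' ij, f ij| ≤ c * ∑' ij, g ij := by
  have hcg : Summable fun ij => c * g ij := hg.mul_left c
  have h1 : ∑' ij, f ij ≤ ∑' ij, c * g ij := Summable.tsum_le_tsum (fun ij => (abs_le.1 (h ij)).2) hf hcg
  have h2 : ∑' ij, -(c * g ij) ≤ ∑' ij, f ij :=
    Summable.tsum_le_tsum (fun ij => by linarith [(abs_le.1 (h ij)).1]) hcg.neg hf
  rw [tsum_neg] at h2
  rw [tsum_mul_left] at h1 h2
  exact abs_le.2 ⟨by linarith, h1⟩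

/-- **Third-order expansion of `L_3` in `s`**: `|L₃(s₀+Δ) − L₃(s₀) + 3Δ·L₄(s₀) − 6Δ²·L₅(s₀)| ≤ 18|Δ|³·L₆(s₀)` (`δ ≤ 1`, `0 < s₀`,
`8|Δ| ≤ s₀`). [this file · kind: proof] -/
theorem layerSum_three_taylor {δ : ℕ} (hδ : δ ≤ 1) {s₀ Δ : ℝ} (hs : 0 < s₀) (hΔ : 8 * |Δ| ≤ s₀) :
    |layerSum δ 3 (s₀ + Δ) - layerSum δ 3 s₀ + 3 * Δ * layerSum δ 4 s₀ - 6 * Δ ^ 2 * layerSum δ 5 s₀|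
      ≤ 18 * |Δ| ^ 3 * layerSum δ 6 s₀ := by
  have hs' : 0 ≤ s₀ + Δ := by linarith [abs_nonneg Δ, neg_abs_le Δ]
  have S3' := layerTerm_summable hδ hs' (n := 3) (by norm_num)
  have S3 := layerTerm_summable hδ hs.le (n := 3) (by norm_num)
  have S4 := (layerTerm_summable hδ hs.le (n := 4) (by norm_num)).mul_left (3 * Δ)
  have S5 := (layerTerm_summable hδ hs.le (n := 5) (by norm_num)).mul_left (6 * Δ ^ 2)
  have S6 := layerTerm_summable hδ hs.le (n := 6) (by norm_num)
  unfold layerSum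
  rw [← tsum_mul_left, ← tsum_mul_left, ← S3'.tsum_sub S3, ← (S3'.sub S3).tsum_add S4,
    ← ((S3'.sub S3).add S4).tsum_sub S5]
  exact abs_tsum_le_of_abs_le (((S3'.sub S3).add S4).sub S5) S6 fun ij => layerTerm_three_taylor hδ hs hΔ ij

/-- **Third-order expansion of `L_6` in `s`**: `|L₆(s₀+Δ) − L₆(s₀) + 6Δ·L₇(s₀) − 21Δ²·L₈(s₀)| ≤ 200|Δ|³·L₉(s₀)`. [this file · kind: proof] -/
theorem layerSum_six_taylor {δ : ℕ} (hδ : δ ≤ 1) {s₀ Δ : ℝ} (hs : 0 < s₀) (hΔ : 8 * |Δ| ≤ s₀) :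
    |layerSum δ 6 (s₀ + Δ) - layerSum δ 6 s₀ + 6 * Δ * layerSum δ 7 s₀ - 21 * Δ ^ 2 * layerSum δ 8 s₀|
      ≤ 200 * |Δ| ^ 3 * layerSum δ 9 s₀ := by
  have hs' : 0 ≤ s₀ + Δ := by linarith [abs_nonneg Δ, neg_abs_le Δ]
  have S6' := layerTerm_summable hδ hs' (n := 6) (by norm_num)
  have S6 := layerTerm_summable hδ hs.le (n := 6) (by norm_num)
  have S7 := (layerTerm_summable hδ hs.le (n := 7) (by norm_num)).mul_left (6 * Δ)
  have S8 := (layerTerm_summable hδ hs.le (n := 8) (by norm_num)).mul_left (21 * Δ ^ 2)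
  have S9 := layerTerm_summable hδ hs.le (n := 9) (by norm_num)
  unfold layerSum
  rw [← tsum_mul_left, ← tsum_mul_left, ← S6'.tsum_sub S6, ← (S6'.sub S6).tsum_add S7,
    ← ((S6'.sub S6).add S7).tsum_sub S8]
  exact abs_tsum_le_of_abs_le (((S6'.sub S6).add S7).sub S8) S9 fun ij => layerTerm_six_taylor hδ hs hΔ ij

/-! ## §4 Registry versions -/

/-- **`J⁽³⁾` to third order**: `|J⁽³⁾(s₀+Δ) − J⁽³⁾(s₀) + 3Δ·J⁽⁴⁾(s₀) − 6Δ²·J⁽⁵⁾(s₀)| ≤ 18|Δ|³·(L⁰₆ + L¹₆)(s₀)` (`0 < s₀`, `8|Δ| ≤ s₀`).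
[this file · kind: proof] -/
theorem registryCoupling_three_taylor {s₀ Δ : ℝ} (hs : 0 < s₀) (hΔ : 8 * |Δ| ≤ s₀) :
    |registryCoupling 3 (s₀ + Δ) - registryCoupling 3 s₀ + 3 * Δ * registryCoupling 4 s₀ - 6 * Δ ^ 2 * registryCoupling 5 s₀|
      ≤ 18 * |Δ| ^ 3 * (layerSum 0 6 s₀ + layerSum 1 6 s₀) := by
  have h0 := layerSum_three_taylor (δ := 0) (by norm_num) hs hΔ
  have h1 := layerSum_three_taylor (δ := 1) le_rfl hs hΔ
  unfold registryCoupling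
  calc _ = |(layerSum 0 3 (s₀ + Δ) - layerSum 0 3 s₀ + 3 * Δ * layerSum 0 4 s₀ - 6 * Δ ^ 2 * layerSum 0 5 s₀)
        - (layerSum 1 3 (s₀ + Δ) - layerSum 1 3 s₀ + 3 * Δ * layerSum 1 4 s₀ - 6 * Δ ^ 2 * layerSum 1 5 s₀)| := by ring_nf
    _ ≤ _ := abs_sub _ _
    _ ≤ _ := add_le_add h0 h1
    _ = 18 * |Δ| ^ 3 * (layerSum 0 6 s₀ + layerSum 1 6 s₀) := by ring

/-- **`J⁽⁶⁾` to third order**: `|J⁽⁶⁾(s₀+Δ) − J⁽⁶⁾(s₀) + 6Δ·J⁽⁷⁾(s₀) − 21Δ²·J⁽⁸⁾(s₀)| ≤ 200|Δ|³·(L⁰₉ + L¹₉)(s₀)`. [this file · kind: proof] -/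
theorem registryCoupling_six_taylor {s₀ Δ : ℝ} (hs : 0 < s₀) (hΔ : 8 * |Δ| ≤ s₀) :
    |registryCoupling 6 (s₀ + Δ) - registryCoupling 6 s₀ + 6 * Δ * registryCoupling 7 s₀ - 21 * Δ ^ 2 * registryCoupling 8 s₀|
      ≤ 200 * |Δ| ^ 3 * (layerSum 0 9 s₀ + layerSum 1 9 s₀) := by
  have h0 := layerSum_six_taylor (δ := 0) (by norm_num) hs hΔ
  have h1 := layerSum_six_taylor (δ := 1) le_rfl hs hΔ
  unfold registryCoupling
  calc _ = |(layerSum 0 6 (s₀ + Δ) - layerSum 0 6 s₀ + 6 * Δ * layerSum 0 7 s₀ - 21 * Δ ^ 2 * layerSum 0 8 s₀)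
        - (layerSum 1 6 (s₀ + Δ) - layerSum 1 6 s₀ + 6 * Δ * layerSum 1 7 s₀ - 21 * Δ ^ 2 * layerSum 1 8 s₀)| := by ring_nf
    _ ≤ _ := abs_sub _ _
    _ ≤ _ := add_le_add h0 h1
    _ = 200 * |Δ| ^ 3 * (layerSum 0 9 s₀ + layerSum 1 9 s₀) := by ring

/-- First-order version for `J⁽³⁾` (for layers where the second-order coefficient is only bounded crudely):
`|J⁽³⁾(s₀+Δ) − J⁽³⁾(s₀) + 3Δ·J⁽⁴⁾(s₀)| ≤ 6Δ²·(L⁰₅ + L¹₅)(s₀) + 18|Δ|³·(L⁰₆ + L¹₆)(s₀)`. [this file · kind: proof] -/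
theorem registryCoupling_three_taylor₁ {s₀ Δ : ℝ} (hs : 0 < s₀) (hΔ : 8 * |Δ| ≤ s₀) :
    |registryCoupling 3 (s₀ + Δ) - registryCoupling 3 s₀ + 3 * Δ * registryCoupling 4 s₀|
      ≤ 6 * Δ ^ 2 * (layerSum 0 5 s₀ + layerSum 1 5 s₀) + 18 * |Δ| ^ 3 * (layerSum 0 6 s₀ + layerSum 1 6 s₀) := by
  have h := registryCoupling_three_taylor hs hΔ
  have p0 : 0 ≤ layerSum 0 5 s₀ := tsum_nonneg fun ij => layerTerm_nonneg (by norm_num) 5 hs.le ij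
  have p1 : 0 ≤ layerSum 1 5 s₀ := tsum_nonneg fun ij => layerTerm_nonneg le_rfl 5 hs.le ij
  have hq : |6 * Δ ^ 2 * registryCoupling 5 s₀| ≤ 6 * Δ ^ 2 * (layerSum 0 5 s₀ + layerSum 1 5 s₀) := by
    rw [abs_mul, abs_of_nonneg (by positivity : (0:ℝ) ≤ 6 * Δ ^ 2)]
    refine mul_le_mul_of_nonneg_left ?_ (by positivity)
    unfold registryCoupling
    rw [abs_le]; constructor <;> linarith
  have := abs_add_le (registryCoupling 3 (s₀ + Δ) - registryCoupling 3 s₀ + 3 * Δ * registryCoupling 4 s₀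
    - 6 * Δ ^ 2 * registryCoupling 5 s₀) (6 * Δ ^ 2 * registryCoupling 5 s₀)
  rw [show registryCoupling 3 (s₀ + Δ) - registryCoupling 3 s₀ + 3 * Δ * registryCoupling 4 s₀
    - 6 * Δ ^ 2 * registryCoupling 5 s₀ + 6 * Δ ^ 2 * registryCoupling 5 s₀ =
    registryCoupling 3 (s₀ + Δ) - registryCoupling 3 s₀ + 3 * Δ * registryCoupling 4 s₀ by ring] at this
  linarith

/-- First-order version for `J⁽⁶⁾`: `|J⁽⁶⁾(s₀+Δ) − J⁽⁶⁾(s₀) + 6Δ·J⁽⁷⁾(s₀)| ≤ 21Δ²·(L⁰₈ + L¹₈)(s₀) + 200|Δ|³·(L⁰₉ + L¹₉)(s₀)`. [this file · kind: proof] -/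
theorem registryCoupling_six_taylor₁ {s₀ Δ : ℝ} (hs : 0 < s₀) (hΔ : 8 * |Δ| ≤ s₀) :
    |registryCoupling 6 (s₀ + Δ) - registryCoupling 6 s₀ + 6 * Δ * registryCoupling 7 s₀|
      ≤ 21 * Δ ^ 2 * (layerSum 0 8 s₀ + layerSum 1 8 s₀) + 200 * |Δ| ^ 3 * (layerSum 0 9 s₀ + layerSum 1 9 s₀) := by
  have h := registryCoupling_six_taylor hs hΔ
  have p0 : 0 ≤ layerSum 0 8 s₀ := tsum_nonneg fun ij => layerTerm_nonneg (by norm_num) 8 hs.le ij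
  have p1 : 0 ≤ layerSum 1 8 s₀ := tsum_nonneg fun ij => layerTerm_nonneg le_rfl 8 hs.le ij
  have hq : |21 * Δ ^ 2 * registryCoupling 8 s₀| ≤ 21 * Δ ^ 2 * (layerSum 0 8 s₀ + layerSum 1 8 s₀) := by
    rw [abs_mul, abs_of_nonneg (by positivity : (0:ℝ) ≤ 21 * Δ ^ 2)]
    refine mul_le_mul_of_nonneg_left ?_ (by positivity)
    unfold registryCoupling
    rw [abs_le]; constructor <;> linarith
  have := abs_add_le (registryCoupling 6 (s₀ + Δ) - registryCoupling 6 s₀ + 6 * Δ * registryCoupling 7 s₀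
    - 21 * Δ ^ 2 * registryCoupling 8 s₀) (21 * Δ ^ 2 * registryCoupling 8 s₀)
  rw [show registryCoupling 6 (s₀ + Δ) - registryCoupling 6 s₀ + 6 * Δ * registryCoupling 7 s₀
    - 21 * Δ ^ 2 * registryCoupling 8 s₀ + 21 * Δ ^ 2 * registryCoupling 8 s₀ =
    registryCoupling 6 (s₀ + Δ) - registryCoupling 6 s₀ + 6 * Δ * registryCoupling 7 s₀ by ring] at this
  linarith

/-! ## §5 The bridge at a general axial ratio -/

/-- Squared norms at spacing `h = a√t`: `‖layerVec a (a√t) δ k i j‖² = a²·(stackForm δ i j + k²t)` (`δ ≤ 1`, `0 ≤ t`). [this file · kind: proof] -/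
theorem normSq_layerVec_sqrt {δ : ℕ} (hδ : δ ≤ 1) (a : ℝ) {t : ℝ} (ht : 0 ≤ t) (k i j : ℤ) :
    ‖layerVec a (a * Real.sqrt t) δ k i j‖ ^ 2 = a ^ 2 * (stackForm δ i j + (k : ℝ) ^ 2 * t) := by
  rw [normSq_layerVec, ← planar_eq_stackForm hδ]
  have h : Real.sqrt t ^ 2 = t := Real.sq_sqrt ht
  linear_combination (k : ℝ) ^ 2 * a ^ 2 * h

/-- Termwise: `V_LJ ‖layerVec a (a√t) δ k i j‖ = (1/12)a⁻¹²·layerTerm δ 6 (k²t) (i,j) − (1/6)a⁻⁶·layerTerm δ 3 (k²t) (i,j)`. [this file · kind: proof] -/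
theorem lennardJones_layerVec_sqrt {δ : ℕ} (hδ : δ ≤ 1) (a : ℝ) {t : ℝ} (ht : 0 ≤ t) (k : ℤ) (ij : ℤ × ℤ) :
    lennardJones ‖layerVec a (a * Real.sqrt t) δ k ij.1 ij.2‖ =
      1 / 12 * (a⁻¹) ^ 12 * layerTerm δ 6 ((k : ℝ) ^ 2 * t) ij - 1 / 6 * (a⁻¹) ^ 6 * layerTerm δ 3 ((k : ℝ) ^ 2 * t) ij := by
  unfold layerTerm
  exact lennardJones_of_sq (normSq_layerVec_sqrt hδ a ht k ij.1 ij.2)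

/-- Layer interactions at spacing `a√t` are layer sums: `layerInteraction lennardJones a (a√t) δ k = (1/12)a⁻¹²·L^δ₆(k²t) − (1/6)a⁻⁶·L^δ₃(k²t)`.
[this file · kind: proof] -/
theorem layerInteraction_lennardJones_sqrt {δ : ℕ} (hδ : δ ≤ 1) (a : ℝ) {t : ℝ} (ht : 0 ≤ t) (k : ℤ) :
    layerInteraction lennardJones a (a * Real.sqrt t) δ k =
      1 / 12 * (a⁻¹) ^ 12 * layerSum δ 6 ((k : ℝ) ^ 2 * t) - 1 / 6 * (a⁻¹) ^ 6 * layerSum δ 3 ((k : ℝ) ^ 2 * t) := by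
  unfold layerInteraction layerSum
  have hs : (0 : ℝ) ≤ (k : ℝ) ^ 2 * t := by positivity
  have h6 := (layerTerm_summable hδ hs (n := 6) (by norm_num)).mul_left (1 / 12 * (a⁻¹) ^ 12)
  have h3 := (layerTerm_summable hδ hs (n := 3) (by norm_num)).mul_left (1 / 6 * (a⁻¹) ^ 6)
  rw [← tsum_mul_left, ← tsum_mul_left, ← h6.tsum_sub h3]
  exact tsum_congr fun ij => lennardJones_layerVec_sqrt hδ a ht k ij

/-- **The bridge at a general axial ratio**: `barlowCoupling lennardJones a (a√t) k = (1/12)a⁻¹²·J⁽⁶⁾(s) − (1/6)a⁻⁶·J⁽³⁾(s)` for `k²t = s`, `0 ≤ t`.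
[this file · kind: proof] -/
theorem barlowCoupling_lennardJones_sqrt (a : ℝ) {t : ℝ} (ht : 0 ≤ t) (k : ℕ) {s : ℝ} (hs : (k : ℝ) ^ 2 * t = s) :
    barlowCoupling lennardJones a (a * Real.sqrt t) k =
      1 / 12 * (a⁻¹) ^ 12 * registryCoupling 6 s - 1 / 6 * (a⁻¹) ^ 6 * registryCoupling 3 s := by
  subst hs
  unfold barlowCoupling registryCoupling
  have h0 := layerInteraction_lennardJones_sqrt (δ := 0) (by norm_num) a ht (k : ℤ)
  have h1 := layerInteraction_lennardJones_sqrt (δ := 1) (by norm_num) a ht (k : ℤ)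
  push_cast at h0 h1
  rw [h0, h1]
  ring

/-- Signed form: `J_k(a, a√t) ≤ (1/12)a⁻¹²·B₆ − (1/6)a⁻⁶·b₃` whenever `J⁽⁶⁾(s) ≤ B₆`, `b₃ ≤ J⁽³⁾(s)`, `k²t = s`. [this file · kind: proof] -/
theorem barlowCoupling_lennardJones_sqrt_le (a : ℝ) {t : ℝ} (ht : 0 ≤ t) (k : ℕ) {s b₃ B₆ : ℝ} (hs : (k : ℝ) ^ 2 * t = s)
    (h3 : b₃ ≤ registryCoupling 3 s) (h6 : registryCoupling 6 s ≤ B₆) :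
    barlowCoupling lennardJones a (a * Real.sqrt t) k ≤ 1 / 12 * (a⁻¹) ^ 12 * B₆ - 1 / 6 * (a⁻¹) ^ 6 * b₃ := by
  rw [barlowCoupling_lennardJones_sqrt a ht k hs]
  have p12 : 0 ≤ 1 / 12 * (a⁻¹) ^ 12 := by positivity
  have p6 : 0 ≤ 1 / 6 * (a⁻¹) ^ 6 := by positivity
  have := mul_le_mul_of_nonneg_left h6 p12
  have := mul_le_mul_of_nonneg_left h3 p6
  linarith

/-- Absolute form: `|J_k(a, a√t)| ≤ (1/12)a⁻¹²·β₆ + (1/6)a⁻⁶·β₃` whenever `|J⁽⁶⁾(s)| ≤ β₆`, `|J⁽³⁾(s)| ≤ β₃`, `k²t = s`. [this file · kind: proof] -/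
theorem abs_barlowCoupling_lennardJones_sqrt_le (a : ℝ) {t : ℝ} (ht : 0 ≤ t) (k : ℕ) {s β₃ β₆ : ℝ} (hs : (k : ℝ) ^ 2 * t = s)
    (h3 : |registryCoupling 3 s| ≤ β₃) (h6 : |registryCoupling 6 s| ≤ β₆) :
    |barlowCoupling lennardJones a (a * Real.sqrt t) k| ≤ 1 / 12 * (a⁻¹) ^ 12 * β₆ + 1 / 6 * (a⁻¹) ^ 6 * β₃ := by
  rw [barlowCoupling_lennardJones_sqrt a ht k hs]
  have p12 : 0 ≤ 1 / 12 * (a⁻¹) ^ 12 := by positivity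
  have p6 : 0 ≤ 1 / 6 * (a⁻¹) ^ 6 := by positivity
  calc |1 / 12 * (a⁻¹) ^ 12 * registryCoupling 6 s - 1 / 6 * (a⁻¹) ^ 6 * registryCoupling 3 s|
      ≤ |1 / 12 * (a⁻¹) ^ 12 * registryCoupling 6 s| + |1 / 6 * (a⁻¹) ^ 6 * registryCoupling 3 s| := abs_sub _ _
    _ = 1 / 12 * (a⁻¹) ^ 12 * |registryCoupling 6 s| + 1 / 6 * (a⁻¹) ^ 6 * |registryCoupling 3 s| := by
        rw [abs_mul (1 / 12 * (a⁻¹) ^ 12), abs_mul (1 / 6 * (a⁻¹) ^ 6), abs_of_nonneg p12, abs_of_nonneg p6]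
    _ ≤ 1 / 12 * (a⁻¹) ^ 12 * β₆ + 1 / 6 * (a⁻¹) ^ 6 * β₃ :=
        add_le_add (mul_le_mul_of_nonneg_left h6 p12) (mul_le_mul_of_nonneg_left h3 p6)

end Summit.AtomisticToContinuum.Crystallization.Theorems.OverbindingBudgetAffineRunCutAxialTaylor

end
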